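import Summits.HodgeConjecture.HodgeConjecture.Theorems.Ring2AbelianAllWeilSign
import Summits.HodgeConjecture.HodgeConjecture.Theorems.Ring2AbelianAllHermitianDet
import Literature.AlgebraicGeometry.HodgeTheory.WeilTypePeriodPoint
import Literature.AlgebraicGeometry.HodgeTheory.WeilTypeAbelianVariety
import HarnessLib

/-!
# Ring 2 · AbelianAll (ab-weil-1, gen 7, part 3/4) — the SIGN of the discriminant: van Geemen's
  Lemma 5.2 (4) `sign det H = (-1)ⁿ` on the carriers

research route, not a corollary; conditional on HC_CM plus one named minimal statement.
Cell line: research route conditional on HC_CM; not a corollary; Q11.4-sentence-2 already refuted in dim ≥ 3.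
`HC_CM` (`Theses.RankFourFaces.CMAbelianHodge`) does not occur in this file, and no open case of the
Hodge conjecture is claimed: the one geometric input is the Hodge–Riemann bilinear relation in degree one
(the tree's `exists_pos_polarizationPairingOne_weilOperatorOne`, Voisin I Thm. 6.32), the rest is
linear algebra (a Hermitian Gram determinant) and the arithmetic of `K_d = ℚ[X]/(X² + d)`.

## What is proved (0 sorry)

Van Geemen (LNM 1594, Lemma 5.2 (4)): for a polarized abelian variety `(X, K = ℚ(√-d), E)` of Weil
type of dimension `2n` the Hermitian form `H = E(x, √-d y) + √-d E(x, y)` on the `K`-vector space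
`H¹(X, ℚ) ≅ K^{2n}` has signature `(n, n)`; consequently (his 5.2 (3)–(4), Markman §1.1)
`det H ∈ ℚ^× / Nm(K^×)` is represented by a rational number of sign `(-1)ⁿ` — the norm residue group
`ℚ^×/Nm(K^×)` remembers the sign because norms from an imaginary quadratic field are positive. The
tree's typed component targets `Ring2.Hypotheses.WeilClassesComponent n d δ` are indexed by ALL
`δ ∈ ℚ^×/Nm(K_d^×)` and their docstring records: "for `(-1)ⁿ·δ < 0` the component is vacuously true
in print; no signature theorem in the tree". Parts 1–4 (`Ring2AbelianAllWeilSign`,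
`Ring2AbelianAllHermitianDet`, this file, `Ring2AbelianAllWeilSignCells`) supply that theorem ON THE CARRIERS:

* parts 1–2: the sign character `weilSign d : ℚ^×/Nm(K_d^×) →* ℤˣ` (`Ring2AbelianAllWeilSign`) and
  the determinant sign of a Hermitian matrix definite of opposite signs on complementary subspaces
  (`det_eq_neg_one_pow_mul_of_definite`, `Ring2AbelianAllHermitianDet`).
* §3 (this file) `neg_one_pow_mul_pos_of_hasWeilDiscriminantNondeg` — **Lemma 5.2 (4) on the carriers**:
  if `(A, φ)` is of Weil type `(n, d)` (`HodgeTheory.IsWeilType`) and `(A, φ, h_K)` carries a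
  non-degenerate discriminant witness of class `δ` (`VanGeemen1994.HasWeilDiscriminantNondeg`,
  `h_K = d·e^*a + φ^*e^*a`), then `δ = [q]` with `(-1)ⁿ q > 0`; packaged:
  `weilSign_eq_of_hasWeilDiscriminantNondeg : weilSign d δ = (-1)ⁿ` and
  `not_hasWeilDiscriminantNondeg_of_weilSign_ne`. Proof: with `ε = i√d`, `u_j = φ^*x_j + ε x_j` is a
  basis of the `ε`-eigenspace `V_ε` (`dim V_ε = 2n`); `Ψ ↦ ℂ` (`√-d ↦ ε`) has entries
  `Q(x_i, u_j)/ω = (i/2ε)·G_ij` with `G_ij = i·Q(ū_i, u_j)/ω` the Gram matrix of the Hermitian form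
  `i Q(ū, v)/ω` on `V_ε` (`Q(V_ε, V_ε) = 0` by `K`-compatibility), which by Hodge–Riemann is definite
  of opposite signs on `V_ε ∩ H^{1,0}` and `V_ε ∩ H^{0,1}` (dimensions `n`, `n` for Weil type); so
  `q = (4d)^{-n} det G` has the sign `(-1)ⁿ`.
* part 4 (`Ring2AbelianAllWeilSignCells`): every typed component `(n, d, δ)` with `sign δ ≠ (-1)ⁿ`
  holds outright; the `δ`-columns of the atlas are halved.

What is NOT proved: existence of a witness (5.2 (1)–(3): every Weil-type `(A, φ, h_K)` HAS a
non-degenerate `det H`; the tree's typed `PolarizedWeilDiscriminantExists`), independence of the class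
from the `K`-basis (5.2 (3)), Landherr's criterion (5.4.1). No Literature fact is introduced.

## References

* [vanGeemen1994HodgeAV] B. van Geemen, An introduction to the Hodge conjecture for abelian varieties,
  LNM 1594 (1994), 4.9, 4.14, Lemma 5.2 (1)–(4), (5.4.1).
* [Markman2025SecantWeil] E. Markman, arXiv:2502.03415 (preprint, unrefereed), §1.1 (the discriminant
  invariant `det H ∈ ℚ^×/Nm(K^×)`).
* [VoisinHodgeI2002] C. Voisin, Hodge Theory and Complex Algebraic Geometry I, Thm. 6.32, §7.1.2.
* [Deligne1982HodgeCycles] P. Deligne, Hodge cycles on abelian varieties, LNM 900, proof of Thm. 4.8.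
-/

noncomputable section

set_option linter.dupNamespace false

open CategoryTheory Polynomial
open Literature.AlgebraicGeometry Literature.AlgebraicGeometry.Motives
open Literature.AlgebraicGeometry.HodgeTheory
open Literature.AlgebraicGeometry.VanGeemen1994
open Literature.AlgebraicTopology.SingularHomology
open Summit.HodgeConjecture.HodgeConjecture.WeilTypeLadder
open Summit.HodgeConjecture.HodgeConjecture.Ring2.Hypotheses

namespace Summit.HodgeConjecture.HodgeConjecture.Ring2.AbelianAll

/-! ### §3 Lemma 5.2 (4) on the carriers: the discriminant class has sign `(-1)ⁿ` -/

section Signature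

open scoped ComplexOrder
open Matrix

/-- The computation behind `neg_one_pow_mul_pos_of_hasWeilDiscriminantNondeg`, with the pairing index
`m = 2n - 1` a free variable (so that `H^{2m+2}` is a syntactic top degree). [cite: vanGeemen1994HodgeAV, Lemma 5.2 (4)] -/
private theorem neg_one_pow_mul_pos_aux {A : AbelianVariety ℂ} {φ : A ⟶ A} {n d m : ℕ}
    (hW : IsWeilType A φ n d) (hmn : 2 * n = m + 1) (e : ProjectiveEmbedding A.X)
    {a : complexBetti (projectiveSpace e.n ℂ) 2} (haQ : IsRationalClass a) (ha0 : a ≠ 0)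
    (x : Fin (2 * n) → complexBetti A.X 1) (ω : complexBetti A.X (2 + 2 * m))
    (am bm : Matrix (Fin (2 * n)) (Fin (2 * n)) ℚ) (q : ℚˣ) (hx : ∀ i, IsRationalClass (x i))
    (hind : LinearIndependent ℂ (Sum.elim x (fun i => complexBetti.map φ.hom.hom.hom 1 (x i))))
    (hω : IsRationalClass ω) (hω0 : ω ≠ 0)
    (hQ : ∀ i j, polarizationPairingOne A.X
          ((d : ℂ) • complexBetti.map e.ι 2 a + complexBetti.map φ.hom.hom.hom 2 (complexBetti.map e.ι 2 a)) m
          (x i) (complexBetti.map φ.hom.hom.hom 1 (x j)) = ((am i j : ℚ) : ℂ) • ω ∧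
        polarizationPairingOne A.X
          ((d : ℂ) • complexBetti.map e.ι 2 a + complexBetti.map φ.hom.hom.hom 2 (complexBetti.map e.ι 2 a)) m
          (x i) (x j) = ((bm i j : ℚ) : ℂ) • ω)
    (hdet : (weilGramMatrix d am bm).det = algebraMap ℚ (weilField d) (q : ℚ)) :
    0 < (-1 : ℚ) ^ n * q := by
  classical
  obtain ⟨hn, hd, hA, hφ, hmult⟩ := hW
  haveI := finite_complexBetti_abelianVariety A 1
  have hm1 : 1 ≤ m := by omega
  have hA' : A.dim = m + 1 := hA.trans hmn
  have hX' : IsSmoothProjective (m + 1) A.X := Motives.isSmoothProjective_of_dim_eq' hA'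
  have hd0 : (d : ℂ) ≠ 0 := Nat.cast_ne_zero.2 hd.ne'
  -- notation: `Y = A(ℂ)`, `h_K`, `Q = Q_{h_K}`, `T = φ^*`, `ε = i√d`
  set Y := ComplexPoints A.X with hYdef
  set hK := (d : ℂ) • complexBetti.map e.ι 2 a + complexBetti.map φ.hom.hom.hom 2 (complexBetti.map e.ι 2 a)
    with hKdef
  set Q := polarizationPairingOne A.X hK m with hQdef
  set T := (complexBetti.map φ.hom.hom.hom 1).hom with hTdef
  set ε : ℂ := Complex.I * (Real.sqrt d : ℂ) with hεdef
  have hε2 : ε * ε = -(d : ℂ) := by rw [← sq]; exact I_mul_sqrt_sq d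
  have hεconj : starRingEnd ℂ ε = -ε := conj_I_mul_sqrt d
  have hε0 : ε ≠ 0 := I_mul_sqrt_ne_zero hd
  have hT2 : ∀ v, T (T v) = -((d : ℂ) • v) := fun v => complexBetti_map_map_one_of_comp_self hφ v
  have hTconj : ∀ v, conjClass Y 1 (T v) = T (conjClass Y 1 v) := fun v => conjClass_map _ v
  have hQTT : ∀ v w, Q (T v) (T w) = (d : ℂ) • Q v w :=
    fun v w => polarizationPairingOne_map_map_ksymm hA' hd hφ e a v w
  have hQswap : ∀ v w, Q w v = -Q v w := fun v w => polarizationPairingOne_swap hK m v w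
  have hQself : ∀ v, Q v v = 0 := fun v => polarizationPairingOne_self hK m v
  have hQconj : ∀ v w, conjClass Y (2 + 2 * m) (Q v w) = Q (conjClass Y 1 v) (conjClass Y 1 w) :=
    fun v w => conjClass_polarizationPairingOne (isRationalClass_ksymm d φ e haQ) m v w
  have hKtype : IsOfHodgeType (m + 1) A.X 2 1 1 hK := isOfHodgeType_one_one_ksymm hA' hd φ e haQ ha0
  have hQ01 : ∀ w ∈ hodgeZeroOne hX', ∀ w' ∈ hodgeZeroOne hX', Q w w' = 0 :=
    fun w hw w' hw' => polarizationPairingOne_eq_zero_of_mem_hodgeZeroOne hX' hKtype hw hw'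
  -- the coordinate `ℓ` on the line `H^{2m+2}` (`c = ℓ c • ω`) and the scalar form `B = ℓ ∘ Q`
  have hline : ∀ c : complexBetti A.X (2 + 2 * m), ∃ r : ℂ, r • ω = c :=
    (finrank_eq_one_iff_of_nonzero' ω hω0).1 (Motives.finrank_complexBetti_two_add_two_mul_eq_one hX')
  obtain ⟨ℓ₀, hℓ₀⟩ := Module.Projective.exists_dual_ne_zero ℂ hω0
  set ℓ : complexBetti A.X (2 + 2 * m) →ₗ[ℂ] ℂ := (ℓ₀ ω)⁻¹ • (ℓ₀ : complexBetti A.X (2 + 2 * m) →ₗ[ℂ] ℂ)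
    with hℓdef
  have hℓω : ℓ ω = 1 := by rw [hℓdef, LinearMap.smul_apply, smul_eq_mul, inv_mul_cancel₀ hℓ₀]
  have hcoord : ∀ c, c = ℓ c • ω := by
    intro c
    obtain ⟨r, rfl⟩ := hline c
    rw [map_smul, smul_eq_mul, hℓω, mul_one]
  set B : complexBetti A.X 1 →ₗ[ℂ] complexBetti A.X 1 →ₗ[ℂ] ℂ := Q.compr₂ ℓ with hBdef
  have hB : ∀ v w, B v w = ℓ (Q v w) := fun v w => rfl
  have hBQ : ∀ v w, Q v w = B v w • ω := fun v w => hcoord _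
  have hBa : ∀ i j, B (x i) (T (x j)) = ((am i j : ℚ) : ℂ) := by
    intro i j; rw [hB, (hQ i j).1, map_smul, hℓω, smul_eq_mul, mul_one]
  have hBb : ∀ i j, B (x i) (x j) = ((bm i j : ℚ) : ℂ) := by
    intro i j; rw [hB, (hQ i j).2, map_smul, hℓω, smul_eq_mul, mul_one]
  have hBTT : ∀ v w, B (T v) (T w) = (d : ℂ) * B v w := by
    intro v w; rw [hB, hQTT, map_smul, smul_eq_mul, hB]
  have hBswap : ∀ v w, B w v = -B v w := by intro v w; rw [hB, hQswap, map_neg, hB]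
  have hBself : ∀ v, B v v = 0 := by intro v; rw [hB, hQself, map_zero]
  have hBconj : ∀ v w, starRingEnd ℂ (B v w) = B (conjClass Y 1 v) (conjClass Y 1 w) := by
    intro v w
    have h := hQconj v w
    rw [hBQ v w, conjClass_smul, hω.conjClass_eq, hBQ (conjClass Y 1 v)] at h
    exact smul_left_injective ℂ hω0 h
  have hB01 : ∀ w ∈ hodgeZeroOne hX', ∀ w' ∈ hodgeZeroOne hX', B w w' = 0 := by
    intro w hw w' hw'; rw [hB, hQ01 w hw w' hw', map_zero]
  -- `V_ε` is `B`-isotropic (`K`-compatibility: `B(Tv, Tw) = d B(v, w)` against `ε² = -d`)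
  have hBiso : ∀ v w, T v = ε • v → T w = ε • w → B v w = 0 := by
    intro v w hv hw
    have h := hBTT v w
    rw [hv, hw] at h
    simp only [map_smul, LinearMap.smul_apply, smul_eq_mul] at h
    have h2 : (2 * (d : ℂ)) * B v w = 0 := by linear_combination -h + (B v w) * hε2
    exact (mul_eq_zero.1 h2).resolve_left (mul_ne_zero two_ne_zero hd0)
  -- Hodge–Riemann for `h_K`, read through `ℓ`: the rational scale `r₀ = ℓ ω₀ ∈ ℝ^×`
  obtain ⟨ω₀, hω₀Q, hω₀0, hpos⟩ := exists_pos_polarizationPairingOne_weilOperatorOne hm1 hA' hd φ e haQ ha0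
  set r₀ : ℂ := ℓ ω₀ with hr₀def
  have hω₀ : ω₀ = r₀ • ω := hcoord ω₀
  have hr₀im : r₀.im = 0 := im_eq_zero_of_smul_eq_of_conjClass_eq hω₀Q.conjClass_eq hω.conjClass_eq hω0 hω₀
  have hr₀0 : r₀ ≠ 0 := fun h => hω₀0 (by rw [hω₀, h, zero_smul])
  set ρ : ℝ := r₀.re with hρdef
  have hr₀real : (ρ : ℂ) = r₀ := Complex.ext (by rw [Complex.ofReal_re]) (by rw [Complex.ofReal_im, hr₀im])
  have hρ0 : ρ ≠ 0 := fun h => hr₀0 (by rw [← hr₀real, h, Complex.ofReal_zero])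
  have hρ2 : 0 < ρ ^ 2 := Even.pow_pos even_two hρ0
  have hr₀conj : starRingEnd ℂ r₀ = r₀ := Complex.conj_eq_iff_im.2 hr₀im
  -- Hodge–Riemann: `B(z, z̄) = t r₀ · (i/2)` with `t > 0`, for `z ∈ H^{1,0} ∖ 0`
  have hHR : ∀ z ∈ hodgeOneZero hX', z ≠ 0 →
      ∃ t : ℝ, 0 < t ∧ B z (conjClass Y 1 z) = ((t : ℂ) * r₀) * (Complex.I / 2) := by
    intro z hz hz0
    have hzb : conjClass Y 1 z ∈ hodgeZeroOne hX' := conjClass_mem_hodgeZeroOne hX' hz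
    have hxreal : conjClass Y 1 (z + conjClass Y 1 z) = z + conjClass Y 1 z := by
      rw [conjClass_add, conjClass_conjClass, add_comm]
    have hx0 : z + conjClass Y 1 z ≠ 0 := by
      intro h0
      have hneg : conjClass Y 1 z = -z := eq_neg_of_add_eq_zero_right h0
      have h10 : conjClass Y 1 z ∈ hodgeOneZero hX' := by rw [hneg]; exact Submodule.neg_mem _ hz
      have hzero : conjClass Y 1 z = 0 := by
        have h' := Submodule.mem_inf.2 ⟨h10, hzb⟩
        rwa [hodgeOneZero_inf_hodgeZeroOne hX', Submodule.mem_bot] at h'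
      apply hz0
      rw [← conjClass_conjClass (Y := Y) (k := 1) z, hzero, conjClass_zero]
    obtain ⟨t, ht, hE⟩ := hpos _ hxreal hx0
    have hC : weilOperatorOne hX' (z + conjClass Y 1 z) = Complex.I • z + -(Complex.I • conjClass Y 1 z) := by
      rw [map_add, weilOperatorOne_of_mem_hodgeOneZero hX' hz, weilOperatorOne_of_mem_hodgeZeroOne hX' hzb]
    have hE' : B (z + conjClass Y 1 z) (Complex.I • z + -(Complex.I • conjClass Y 1 z)) = (t : ℂ) * r₀ := by
      rw [← hC, hB]
      have hE₁ : Q (z + conjClass Y 1 z) (weilOperatorOne hX' (z + conjClass Y 1 z)) = (t : ℂ) • ω₀ := hE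
      rw [hE₁, hω₀, smul_smul, map_smul, hℓω, smul_eq_mul, mul_one]
    have hcz : B (conjClass Y 1 z) z = -B z (conjClass Y 1 z) := hBswap _ _
    simp only [map_add, map_neg, map_smul, LinearMap.add_apply, smul_eq_mul, hBself, hcz] at hE'
    refine ⟨t, ht, ?_⟩
    linear_combination (Complex.I / 2) * hE' + (B z (conjClass Y 1 z)) * Complex.I_mul_I
  -- the basis `u_j = T x_j + ε x_j` of `V_ε`
  set u : Fin (2 * n) → complexBetti A.X 1 := fun j => T (x j) + ε • x j with hudef
  have hu_eig : ∀ j, T (u j) = ε • u j := fun j => by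
    simp only [hudef, map_add, map_smul, hT2, smul_add, smul_smul, hε2, neg_smul]; abel
  have hubar : ∀ j, conjClass Y 1 (u j) = T (x j) - ε • x j := fun j => by
    simp only [hudef]
    rw [conjClass_add, hTconj, (hx j).conjClass_eq, conjClass_smul, (hx j).conjClass_eq, hεconj, neg_smul,
      sub_eq_add_neg]
  have hxu : ∀ i, (2 * ε) • x i = u i - conjClass Y 1 (u i) := fun i => by
    rw [hubar]; simp only [hudef, mul_smul, two_smul]; abel
  have hBxu : ∀ i j, B (x i) (u j) = ((am i j : ℚ) : ℂ) + ((bm i j : ℚ) : ℂ) * ε := fun i j => by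
    simp only [hudef]; rw [map_add, map_smul, hBa, hBb, smul_eq_mul, mul_comm]
  have hli : LinearIndependent ℂ u := linearIndependent_map_add_smul T x ε hind
  set Φ : (Fin (2 * n) → ℂ) →ₗ[ℂ] complexBetti A.X 1 := Fintype.linearCombination ℂ u with hΦdef
  have hΦapply : ∀ c, Φ c = ∑ j, c j • u j := fun c => Fintype.linearCombination_apply ℂ u c
  have hinj : Function.Injective Φ := hli.fintypeLinearCombination_injective
  have hΦconj : ∀ c, conjClass Y 1 (Φ c) = ∑ j, starRingEnd ℂ (c j) • conjClass Y 1 (u j) := fun c => by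
    rw [hΦapply, conjClass_sum_smul]
  -- `range Φ = V_ε`, of dimension `2n`
  have hVε : Module.finrank ℂ (Module.End.eigenspace T ε) = 2 * n := by
    have h := two_mul_finrank_eigenspace_eq hd hφ
    rw [Motives.AbelianVariety.finrank_complexBetti_one, hA] at h
    change 2 * Module.finrank ℂ (Module.End.eigenspace T ε) = _ at h
    omega
  have hle : LinearMap.range Φ ≤ Module.End.eigenspace T ε := by
    rw [hΦdef, Fintype.range_linearCombination]
    refine Submodule.span_le.2 ?_
    rintro _ ⟨j, rfl⟩
    exact Module.End.mem_eigenspace_iff.2 (hu_eig j)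
  have hrange : LinearMap.range Φ = Module.End.eigenspace T ε :=
    Submodule.eq_of_le_of_finrank_eq hle (by rw [LinearMap.finrank_range_of_inj hinj, Module.finrank_fin_fun, hVε])
  have hΦeig : ∀ c, T (Φ c) = ε • Φ c := fun c =>
    Module.End.mem_eigenspace_iff.1 (hrange ▸ LinearMap.mem_range_self Φ c)
  -- the splitting `ℂ^{2n} = Φ⁻¹ H^{1,0} ⊕ Φ⁻¹ H^{0,1}`
  have hPN : IsCompl ((hodgeOneZero hX').comap Φ) ((hodgeZeroOne hX').comap Φ) := by
    refine ⟨Submodule.disjoint_def.2 fun c hc1 hc2 => ?_, codisjoint_iff.2 (eq_top_iff.2 fun c _ => ?_)⟩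
    · have h0 : Φ c = 0 := by
        have h' := Submodule.mem_inf.2 ⟨Submodule.mem_comap.1 hc1, Submodule.mem_comap.1 hc2⟩
        rwa [hodgeOneZero_inf_hodgeZeroOne hX', Submodule.mem_bot] at h'
      exact hinj (by rw [h0, map_zero])
    · obtain ⟨α, β, hαβ, hα, hβ⟩ := exists_add_eq_of_isOfHodgeType_one hX' (Φ c)
      obtain ⟨hTα, hTβ⟩ := eigenvector_components hX' φ.hom.hom.hom ε (hΦeig c) hαβ hα hβ
      obtain ⟨cα, hcα⟩ := LinearMap.mem_range.1
        (show α ∈ LinearMap.range Φ by rw [hrange]; exact Module.End.mem_eigenspace_iff.2 hTα)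
      obtain ⟨cβ, hcβ⟩ := LinearMap.mem_range.1
        (show β ∈ LinearMap.range Φ by rw [hrange]; exact Module.End.mem_eigenspace_iff.2 hTβ)
      have hc : c = cα + cβ := hinj (by rw [map_add, hcα, hcβ, hαβ])
      rw [hc]
      exact Submodule.add_mem_sup (Submodule.mem_comap.2 (by rw [hcα]; exact hα))
        (Submodule.mem_comap.2 (by rw [hcβ]; exact hβ))
  -- dimension count: `dim Φ⁻¹ H^{0,1} = dim (V_ε ∩ H^{0,1}) = 2n - n = n` (Weil type)
  have hH10 : hodgeOneZero (Motives.isSmoothProjective_of_dim_eq' hA) = hodgeOneZero hX' :=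
    hodgeOneZero_congr hmn _ _
  have hH01 : hodgeZeroOne (Motives.isSmoothProjective_of_dim_eq' hA) = hodgeZeroOne hX' :=
    hodgeZeroOne_congr hmn _ _
  have hq_n : Module.finrank ℂ ↥(Module.End.eigenspace T ε ⊓ hodgeZeroOne hX') = n := by
    have h := finrank_inf_hodgeOneZero_add_finrank_inf_hodgeZeroOne hA hd hφ
    rw [hH10, hH01, ← hTdef, ← hεdef] at h
    rw [hH10] at hmult
    omega
  have hfinN : Module.finrank ℂ ((hodgeZeroOne hX').comap Φ) = n := by
    rw [(Submodule.equivMapOfInjective Φ hinj _).finrank_eq, Submodule.map_comap_eq, hrange]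
    exact hq_n
  -- the Gram matrix `G_ij = i B(ū_i, u_j)` of the Hermitian form `i B(v̄, w)` on `V_ε`, scaled by `r₀`
  set G : Matrix (Fin (2 * n)) (Fin (2 * n)) ℂ :=
    Matrix.of fun i j => Complex.I * B (conjClass Y 1 (u i)) (u j) with hGdef
  have hform : ∀ c c' : Fin (2 * n) → ℂ,
      star c ⬝ᵥ (r₀ • G) *ᵥ c' = r₀ * (Complex.I * B (conjClass Y 1 (Φ c)) (Φ c')) := by
    intro c c'
    rw [Matrix.smul_mulVec, dotProduct_smul, smul_eq_mul, hGdef, star_dotProduct_gram_mulVec, hΦconj, hΦapply]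
  have hGentry : ∀ i j, starRingEnd ℂ (G j i) = G i j := by
    intro i j
    simp only [hGdef, Matrix.of_apply, map_mul, Complex.conj_I, hBconj, conjClass_conjClass,
      hBswap (conjClass Y 1 (u i)) (u j)]
    ring
  have hGH : (r₀ • G).IsHermitian := by
    refine Matrix.IsHermitian.ext fun i j => ?_
    rw [Matrix.smul_apply, Matrix.smul_apply, smul_eq_mul, smul_eq_mul, Complex.star_def, map_mul, hr₀conj,
      hGentry]
  have horth : ∀ p ∈ (hodgeOneZero hX').comap Φ, ∀ p' ∈ (hodgeZeroOne hX').comap Φ,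
      star p ⬝ᵥ (r₀ • G) *ᵥ p' = 0 := by
    intro p hp p' hp'
    rw [hform, hB01 _ (conjClass_mem_hodgeZeroOne hX' (Submodule.mem_comap.1 hp)) _ (Submodule.mem_comap.1 hp'),
      mul_zero, mul_zero]
  have hposP : ∀ p ∈ (hodgeOneZero hX').comap Φ, p ≠ 0 → 0 < star p ⬝ᵥ (r₀ • G) *ᵥ p := by
    intro p hp hp0
    have hz : Φ p ∈ hodgeOneZero hX' := Submodule.mem_comap.1 hp
    have hz0 : Φ p ≠ 0 := fun h => hp0 (hinj (by rw [h, map_zero]))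
    obtain ⟨t, ht, hBz⟩ := hHR _ hz hz0
    have hval : star p ⬝ᵥ (r₀ • G) *ᵥ p = ((t * ρ ^ 2 / 2 : ℝ) : ℂ) := by
      rw [hform, hBswap, hBz, ← hr₀real]
      push_cast
      linear_combination (-((t : ℂ) * (ρ : ℂ) ^ 2 / 2)) * Complex.I_mul_I
    rw [hval, ← Complex.ofReal_zero, Complex.real_lt_real]
    exact div_pos (mul_pos ht hρ2) two_pos
  have hnegN : ∀ p ∈ (hodgeZeroOne hX').comap Φ, p ≠ 0 → star p ⬝ᵥ (r₀ • G) *ᵥ p < 0 := by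
    intro p hp hp0
    have hw : Φ p ∈ hodgeZeroOne hX' := Submodule.mem_comap.1 hp
    have hw0 : Φ p ≠ 0 := fun h => hp0 (hinj (by rw [h, map_zero]))
    have hz : conjClass Y 1 (Φ p) ∈ hodgeOneZero hX' := conjClass_mem_hodgeOneZero hX' hw
    have hz0 : conjClass Y 1 (Φ p) ≠ 0 := fun h => hw0 (by
      rw [← conjClass_conjClass (Y := Y) (k := 1) (Φ p), h, conjClass_zero])
    obtain ⟨t, ht, hBz⟩ := hHR _ hz hz0
    rw [conjClass_conjClass] at hBz
    have hval : star p ⬝ᵥ (r₀ • G) *ᵥ p = ((-(t * ρ ^ 2 / 2) : ℝ) : ℂ) := by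
      rw [hform, hBz, ← hr₀real]
      push_cast
      linear_combination ((t : ℂ) * (ρ : ℂ) ^ 2 / 2) * Complex.I_mul_I
    rw [hval, ← Complex.ofReal_zero, Complex.real_lt_real]
    linarith [div_pos (mul_pos ht hρ2) two_pos]
  -- the determinant of `r₀ • G` has sign `(-1)ⁿ`
  obtain ⟨r, hr, hdetG⟩ := det_eq_neg_one_pow_mul_of_definite hGH hPN horth hposP hnegN
  rw [hfinN, Matrix.det_smul, Fintype.card_fin] at hdetG
  -- `Ψ ↦ ℂ` under `√-d ↦ ε` is `(2ε)⁻¹ i · G`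
  obtain ⟨σ, hσε, hσq⟩ := exists_ringHom_weilField_sqrt d
  have hM : σ.mapMatrix (weilGramMatrix d am bm) = ((2 * ε)⁻¹ * Complex.I) • G := by
    ext i j
    rw [RingHom.mapMatrix_apply, Matrix.map_apply, weilGramMatrix_apply, map_add, map_mul, hσq, hσq, hσε,
      Matrix.smul_apply, smul_eq_mul, hGdef, Matrix.of_apply]
    have h := congrArg (fun v => B v (u j)) (hxu i)
    simp only [map_smul, map_sub, LinearMap.smul_apply, LinearMap.sub_apply, smul_eq_mul,
      hBiso (u i) (u j) (hu_eig i) (hu_eig j), hBxu] at h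
    have hinv : 2 * ε * (2 * ε)⁻¹ = 1 := mul_inv_cancel₀ (mul_ne_zero two_ne_zero hε0)
    linear_combination (2 * ε)⁻¹ * h - ((((am i j : ℚ) : ℂ)) + ((bm i j : ℚ) : ℂ) * ε) * hinv -
      ((2 * ε)⁻¹ * B (conjClass Y 1 (u i)) (u j)) * Complex.I_mul_I
  have hdetC : ((q : ℚ) : ℂ) = ((2 * ε)⁻¹ * Complex.I) ^ (2 * n) * G.det := by
    have h := congrArg σ hdet
    rw [RingHom.map_det, hσq, hM, Matrix.det_smul, Fintype.card_fin] at h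
    exact h.symm
  exact neg_one_pow_mul_pos_of_det_eq hd hε2 hr₀real hρ0 hr hdetG hdetC

/-- **Van Geemen, Lemma 5.2 (4), on the carriers: the discriminant of a Weil-type polarization has sign
`(-1)ⁿ`.** Let `(A, φ)` be of Weil type `(n, d)` (`HodgeTheory.IsWeilType`: `dim A = 2n ≥ 2`, `φ² = -d`,
`d ≥ 1`, `i√d` of multiplicity `n` on `H^{1,0}`), `e` a projective embedding, `a ≠ 0` rational, and
`h_K = d·e^*a + φ^*e^*a`. If `(A, φ, h_K)` carries a NON-DEGENERATE discriminant witness of class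
`δ ∈ ℚ^×/Nm(K_d^×)` (`VanGeemen1994.HasWeilDiscriminantNondeg`), then `δ = [q]` with `(-1)ⁿ q > 0`.
In print: "`H` has signature `(n, n)`" (5.2 (4)), whence `det Ψ` has sign `(-1)ⁿ` (4.14, 5.4: Weil-type
families with `det H = x` exist only for `(-1)ⁿ x > 0`). Proof: module docstring (Hodge–Riemann in
degree one for `h_K`, `exists_pos_polarizationPairingOne_weilOperatorOne`; Hermitian Gram determinant,
`det_eq_neg_one_pow_mul_of_definite`). [cite: vanGeemen1994HodgeAV, Lemma 5.2 (4), 4.14 and 5.4]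
[cite: VoisinHodgeI2002, Thm. 6.32] [cite: Deligne1982HodgeCycles, proof of Thm. 4.8] -/
theorem neg_one_pow_mul_pos_of_hasWeilDiscriminantNondeg {A : AbelianVariety ℂ} {φ : A ⟶ A} {n d : ℕ}
    (hW : IsWeilType A φ n d) (e : ProjectiveEmbedding A.X) {a : complexBetti (projectiveSpace e.n ℂ) 2}
    (haQ : IsRationalClass a) (ha0 : a ≠ 0) {δ : weilNormResidueGroup d}
    (hδ : HasWeilDiscriminantNondeg A φ n d
      ((d : ℂ) • complexBetti.map e.ι 2 a + complexBetti.map φ.hom.hom.hom 2 (complexBetti.map e.ι 2 a)) δ) :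
    ∃ q : ℚˣ, (QuotientGroup.mk q : weilNormResidueGroup d) = δ ∧ 0 < (-1 : ℚ) ^ n * q := by
  obtain ⟨x, ω, am, bm, q, hx, hind, hω, hω0, hQ, hdet, hq⟩ := hδ
  exact ⟨q, hq, neg_one_pow_mul_pos_aux hW (by have := hW.pos; omega) e haQ ha0 x ω am bm q hx hind hω hω0 hQ
    hdet⟩

/-- **Lemma 5.2 (4), sign form: `sign det H = (-1)ⁿ`.** For `(A, φ)` of Weil type `(n, d)` and a
non-degenerate discriminant witness of class `δ` for `h_K = d·e^*a + φ^*e^*a`: `weilSign d δ = (-1)ⁿ`.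
[cite: vanGeemen1994HodgeAV, Lemma 5.2 (4) and 4.14] -/
theorem weilSign_eq_of_hasWeilDiscriminantNondeg {A : AbelianVariety ℂ} {φ : A ⟶ A} {n d : ℕ}
    (hW : IsWeilType A φ n d) (e : ProjectiveEmbedding A.X) {a : complexBetti (projectiveSpace e.n ℂ) 2}
    (haQ : IsRationalClass a) (ha0 : a ≠ 0) {δ : weilNormResidueGroup d}
    (hδ : HasWeilDiscriminantNondeg A φ n d
      ((d : ℂ) • complexBetti.map e.ι 2 a + complexBetti.map φ.hom.hom.hom 2 (complexBetti.map e.ι 2 a)) δ) :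
    weilSign d δ = (-1) ^ n := by
  obtain ⟨q, rfl, hq⟩ := neg_one_pow_mul_pos_of_hasWeilDiscriminantNondeg hW e haQ ha0 hδ
  exact (weilSign_mk_eq_neg_one_pow_iff d q n).2 hq

/-- **No Weil-type `(A, φ, h_K)` carries a non-degenerate discriminant of the wrong sign.**
[cite: vanGeemen1994HodgeAV, Lemma 5.2 (4) and 4.14] -/
theorem not_hasWeilDiscriminantNondeg_of_weilSign_ne {A : AbelianVariety ℂ} {φ : A ⟶ A} {n d : ℕ}
    (hW : IsWeilType A φ n d) (e : ProjectiveEmbedding A.X) {a : complexBetti (projectiveSpace e.n ℂ) 2}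
    (haQ : IsRationalClass a) (ha0 : a ≠ 0) {δ : weilNormResidueGroup d} (hδ : weilSign d δ ≠ (-1) ^ n) :
    ¬ HasWeilDiscriminantNondeg A φ n d
      ((d : ℂ) • complexBetti.map e.ι 2 a + complexBetti.map φ.hom.hom.hom 2 (complexBetti.map e.ι 2 a)) δ :=
  fun h => hδ (weilSign_eq_of_hasWeilDiscriminantNondeg hW e haQ ha0 h)

end Signature


end Summit.HodgeConjecture.HodgeConjecture.Ring2.AbelianAll

end
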